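import Summits.ValiantsHypothesis.ValiantsHypothesis.Theorems.SymPencilPerFourPeeledTwoPencilReduction

/-!
# `SdcSuperquadratic` (stmt-ValiantsHypothesis-5674), (8,8) column — NEGATIVE lane:
# the `∀ Ψ` two-pencil frame hypothesis `hframes` of `…PeeledTwoPencilReduction` is FALSE

Refuter (critic val-idea-crit-5 g4) certificate, 2026-08-29.  The reduction
`…SymPencilPerFourPeeledTwoPencilReduction.false_of_peeled_of_frames` (and its corollaries
`IR11_of_frames`, `false_of_rank_eight_le_twentyEight_of_frames`) is hypothesised on

  `hframes : ∀ Ψ : K^{4×4}, ∃ a₀ a₁ y₀ y₁ P₀₀ P₁₀ P₀₁ P₁₁ W₀ v s W, …` (a two-pencil frame for EVERY `Ψ`).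

**Theorem** (`no_twoPencilFrame_swap`).  For the pure swap `Ψ = E₀₁ + E₁₀` there is NO two-pencil frame,
over any field.  Hence (`not_twoPencilFrames_forall`) `hframes` is false over every field and the three
theorems of `…PeeledTwoPencilReduction` are vacuously hypothesised: the cell `(8,8,11)` of `m = 28` is
NOT reduced to them.  (The two-pencil ENGINE `…PeeledTwoPencilDesign.false_of_frame`, which needs a
frame only for the `Ψ` of the family at hand, is untouched.)

Proof.  The four incidences read `a_j 0 * y_i 1 + a_j 1 * y_i 0 = 0`.  By `permanent_of_rows` the pure
matrix `P(a,y)[b][l] = per(a; e_b; y; e_l)` has zero diagonal and off-diagonal entry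
`a_c y_d + a_d y_c` for `{c,d}` the complement of `{b,l}`; the incidence is exactly the entry
`P[2][3] = P[3][2]`, so `P₀₀`, `P₁₀` have the block shape `[[A, B], [Bᵀ, 0]]` with a ZERO lower-right
`2 × 2` block.  If `det B₀₀ = 0` then `P₀₀` kills a non-zero vector `(0,0,g)` — contradicting
`W₀ * P₀₀ = 1`.  Otherwise every pencil eigenvalue `s j` (`P₁₀ v_j = s_j P₀₀ v_j`, `v_j ≠ 0` as
`W * of v = 1`) is a root of the quadratic `q(s) = det (B₁₀ - s • B₀₀)` (read off rows `2,3` of the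
eigen-relation when the head `(v_j 0, v_j 1)` is non-zero, off rows `0,1` otherwise), whose leading
coefficient is `det B₀₀ ≠ 0`; three pairwise distinct roots `s 0, s 1, s 2` of a non-zero quadratic
are impossible.

No definitions; no conclusion asserts a Theses declaration; `--supports` stmt-ValiantsHypothesis-5674
(rung bookkeeping of the `(8,8)` column only — nothing here bears on `VP ≠ VNP`). [folklore]
-/

namespace Summit.ValiantsHypothesis.ValiantsHypothesis.Theorems.SdcSuperquadratic.Negative

-- single-conjunct layout: Sub = Summit, duplicated namespace component intended
set_option linter.dupNamespace false

open Matrix Finset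
open Summit.ValiantsHypothesis.ValiantsHypothesis.Theorems.SymPencilPerFourInnerRankRows
  (permanent_of_rows)

universe u

variable {K : Type u} [Field K]

/-- Entries of a pure permanent matrix `P[b][l] = per(a; e_b; y; e_l)` under the swap incidence
`a 0 * y 1 + a 1 * y 0 = 0`: block shape `[[A, B], [Bᵀ, 0]]`. [folklore] -/
theorem twoPencil_pure_matrix_eq (a y : Fin 4 → K) (P : Matrix (Fin 4) (Fin 4) K)
    (hP : ∀ b l, P b l = (Matrix.of ![a, Pi.single b 1, y, Pi.single l 1]).permanent)
    (hc : a 0 * y 1 + a 1 * y 0 = 0) :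
    P = Matrix.of ![![0, a 2 * y 3 + a 3 * y 2, a 1 * y 3 + a 3 * y 1, a 1 * y 2 + a 2 * y 1],
      ![a 2 * y 3 + a 3 * y 2, 0, a 0 * y 3 + a 3 * y 0, a 0 * y 2 + a 2 * y 0],
      ![a 1 * y 3 + a 3 * y 1, a 0 * y 3 + a 3 * y 0, 0, 0],
      ![a 1 * y 2 + a 2 * y 1, a 0 * y 2 + a 2 * y 0, 0, 0]] := by
  ext b l
  fin_cases b <;> fin_cases l <;> simp [hP, permanent_of_rows] <;> linear_combination hc

/-- **No two-pencil frame at the pure swap `Ψ = E₀₁ + E₁₀`** (the `∃`-body is the `hframes` body of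
`…PeeledTwoPencilReduction.false_of_peeled_of_frames` at this `Ψ`, verbatim). [folklore] -/
theorem no_twoPencilFrame_swap (K : Type u) [Field K] :
    ¬ ∃ (a₀ a₁ y₀ y₁ : Fin 4 → K) (P₀₀ P₁₀ P₀₁ P₁₁ W₀ : Matrix (Fin 4) (Fin 4) K)
        (v : Fin 4 → Fin 4 → K) (s : Fin 4 → K) (W : Matrix (Fin 4) (Fin 4) K),
        a₀ ⬝ᵥ (Matrix.of ![![0, 1, 0, 0], ![1, 0, 0, 0], ![0, 0, 0, 0], ![0, 0, 0, 0]] :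
            Matrix (Fin 4) (Fin 4) K) *ᵥ y₀ = 0 ∧
        a₀ ⬝ᵥ (Matrix.of ![![0, 1, 0, 0], ![1, 0, 0, 0], ![0, 0, 0, 0], ![0, 0, 0, 0]] :
            Matrix (Fin 4) (Fin 4) K) *ᵥ y₁ = 0 ∧
        a₁ ⬝ᵥ (Matrix.of ![![0, 1, 0, 0], ![1, 0, 0, 0], ![0, 0, 0, 0], ![0, 0, 0, 0]] :
            Matrix (Fin 4) (Fin 4) K) *ᵥ y₀ = 0 ∧
        a₁ ⬝ᵥ (Matrix.of ![![0, 1, 0, 0], ![1, 0, 0, 0], ![0, 0, 0, 0], ![0, 0, 0, 0]] :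
            Matrix (Fin 4) (Fin 4) K) *ᵥ y₁ = 0 ∧
        (∀ b l, P₀₀ b l = (Matrix.of ![a₀, Pi.single b 1, y₀, Pi.single l 1]).permanent) ∧
        (∀ b l, P₁₀ b l = (Matrix.of ![a₀, Pi.single b 1, y₁, Pi.single l 1]).permanent) ∧
        (∀ b l, P₀₁ b l = (Matrix.of ![a₁, Pi.single b 1, y₀, Pi.single l 1]).permanent) ∧
        (∀ b l, P₁₁ b l = (Matrix.of ![a₁, Pi.single b 1, y₁, Pi.single l 1]).permanent) ∧
        W₀ * P₀₀ = 1 ∧ (∀ j, P₁₀ *ᵥ v j = s j • P₀₀ *ᵥ v j) ∧ (∀ i j, i ≠ j → s i ≠ s j) ∧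
        W * Matrix.of v = 1 ∧ P₁₁ - P₁₀ * W₀ * P₀₁ ≠ 0 := by
  rintro ⟨a₀, a₁, y₀, y₁, P₀₀, P₁₀, P₀₁, P₁₁, W₀, v, s, W, h00, h01, -, -, hP₀₀, hP₁₀, -, -, hW₀, hv,
    hs, hW, -⟩
  -- the two incidences through `a₀`
  have c0 : a₀ 0 * y₀ 1 + a₀ 1 * y₀ 0 = 0 := by
    have h := h00
    simp [Matrix.mulVec, dotProduct, Fin.sum_univ_four] at h
    linear_combination h
  have c1 : a₀ 0 * y₁ 1 + a₀ 1 * y₁ 0 = 0 := by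
    have h := h01
    simp [Matrix.mulVec, dotProduct, Fin.sum_univ_four] at h
    linear_combination h
  -- the block shape of `P₀₀`, `P₁₀`
  have hP0 := twoPencil_pure_matrix_eq a₀ y₀ P₀₀ hP₀₀ c0
  have hP1 := twoPencil_pure_matrix_eq a₀ y₁ P₁₀ hP₁₀ c1
  subst hP0 hP1
  -- every `v j` is non-zero (`of v` is invertible)
  have vne : ∀ j, v j ≠ 0 := by
    intro j hj
    have h1 : (W * Matrix.of v).det = 1 := by rw [hW, Matrix.det_one]
    rw [Matrix.det_mul, Matrix.det_eq_zero_of_row_eq_zero (A := Matrix.of v) j (fun k => by simp [hj]),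
      mul_zero] at h1
    exact zero_ne_one h1
  -- the leading coefficient `α = det B₀₀` is non-zero: else `P₀₀` kills a non-zero `(0, 0, g)`
  have hα : (a₀ 1 * y₀ 3 + a₀ 3 * y₀ 1) * (a₀ 0 * y₀ 2 + a₀ 2 * y₀ 0) - (a₀ 0 * y₀ 3 + a₀ 3 * y₀ 0) * (a₀ 1 * y₀ 2 + a₀ 2 * y₀ 1) ≠ 0 := by
    intro hα
    -- a non-zero `g` with `B₀₀ g = 0`
    obtain ⟨g2, g3, hg, e0, e1⟩ : ∃ g2 g3 : K, ¬ (g2 = 0 ∧ g3 = 0) ∧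
        (a₀ 1 * y₀ 3 + a₀ 3 * y₀ 1) * g2 + (a₀ 1 * y₀ 2 + a₀ 2 * y₀ 1) * g3 = 0 ∧ (a₀ 0 * y₀ 3 + a₀ 3 * y₀ 0) * g2 + (a₀ 0 * y₀ 2 + a₀ 2 * y₀ 0) * g3 = 0 := by
      by_cases hr : (a₀ 1 * y₀ 3 + a₀ 3 * y₀ 1) = 0 ∧ (a₀ 1 * y₀ 2 + a₀ 2 * y₀ 1) = 0
      · by_cases hr' : (a₀ 0 * y₀ 3 + a₀ 3 * y₀ 0) = 0 ∧ (a₀ 0 * y₀ 2 + a₀ 2 * y₀ 0) = 0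
        · exact ⟨1, 0, by simp, by rw [hr.1]; ring, by rw [hr'.1]; ring⟩
        · refine ⟨(a₀ 0 * y₀ 2 + a₀ 2 * y₀ 0), -(a₀ 0 * y₀ 3 + a₀ 3 * y₀ 0), ?_, by rw [hr.1, hr.2]; ring, by ring⟩
          rintro ⟨h2, h3⟩
          exact hr' ⟨neg_eq_zero.1 h3, h2⟩
      · refine ⟨(a₀ 1 * y₀ 2 + a₀ 2 * y₀ 1), -(a₀ 1 * y₀ 3 + a₀ 3 * y₀ 1), ?_, by ring, by linear_combination (-1 : K) * hα⟩
        rintro ⟨h2, h3⟩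
        exact hr ⟨neg_eq_zero.1 h3, h2⟩
    set x : Fin 4 → K := ![0, 0, g2, g3] with hx
    have hPx : (Matrix.of ![![0, a₀ 2 * y₀ 3 + a₀ 3 * y₀ 2, a₀ 1 * y₀ 3 + a₀ 3 * y₀ 1,
          a₀ 1 * y₀ 2 + a₀ 2 * y₀ 1],
        ![a₀ 2 * y₀ 3 + a₀ 3 * y₀ 2, 0, a₀ 0 * y₀ 3 + a₀ 3 * y₀ 0, a₀ 0 * y₀ 2 + a₀ 2 * y₀ 0],
        ![a₀ 1 * y₀ 3 + a₀ 3 * y₀ 1, a₀ 0 * y₀ 3 + a₀ 3 * y₀ 0, 0, 0],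
        ![a₀ 1 * y₀ 2 + a₀ 2 * y₀ 1, a₀ 0 * y₀ 2 + a₀ 2 * y₀ 0, 0, 0]] : Matrix (Fin 4) (Fin 4) K)
          *ᵥ x = 0 := by
      funext i
      fin_cases i <;> simp [x, Matrix.mulVec, dotProduct, Fin.sum_univ_four]
      · linear_combination e0
      · linear_combination e1
    have hx0 : x = 0 := by
      have h := congr_arg (fun M : Matrix (Fin 4) (Fin 4) K => M *ᵥ x) hW₀
      simp only [← Matrix.mulVec_mulVec, hPx, Matrix.mulVec_zero, Matrix.one_mulVec] at h
      exact h.symm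
    apply hg
    have h2 := congr_fun hx0 2
    have h3 := congr_fun hx0 3
    simp [x] at h2 h3
    exact ⟨h2, h3⟩
  -- the four rows of the eigen-relation `P₁₀ v_j = s_j P₀₀ v_j`
  have r0 : ∀ j, (a₀ 2 * y₁ 3 + a₀ 3 * y₁ 2) * v j 1 + (a₀ 1 * y₁ 3 + a₀ 3 * y₁ 1) * v j 2 +
      (a₀ 1 * y₁ 2 + a₀ 2 * y₁ 1) * v j 3 = s j * ((a₀ 2 * y₀ 3 + a₀ 3 * y₀ 2) * v j 1 +
      (a₀ 1 * y₀ 3 + a₀ 3 * y₀ 1) * v j 2 + (a₀ 1 * y₀ 2 + a₀ 2 * y₀ 1) * v j 3) := fun j => by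
    have h := congr_fun (hv j) 0
    simp [Matrix.mulVec, dotProduct, Fin.sum_univ_four] at h
    linear_combination h
  have r1 : ∀ j, (a₀ 2 * y₁ 3 + a₀ 3 * y₁ 2) * v j 0 + (a₀ 0 * y₁ 3 + a₀ 3 * y₁ 0) * v j 2 +
      (a₀ 0 * y₁ 2 + a₀ 2 * y₁ 0) * v j 3 = s j * ((a₀ 2 * y₀ 3 + a₀ 3 * y₀ 2) * v j 0 +
      (a₀ 0 * y₀ 3 + a₀ 3 * y₀ 0) * v j 2 + (a₀ 0 * y₀ 2 + a₀ 2 * y₀ 0) * v j 3) := fun j => by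
    have h := congr_fun (hv j) 1
    simp [Matrix.mulVec, dotProduct, Fin.sum_univ_four] at h
    linear_combination h
  have r2 : ∀ j, (a₀ 1 * y₁ 3 + a₀ 3 * y₁ 1) * v j 0 + (a₀ 0 * y₁ 3 + a₀ 3 * y₁ 0) * v j 1 =
      s j * ((a₀ 1 * y₀ 3 + a₀ 3 * y₀ 1) * v j 0 + (a₀ 0 * y₀ 3 + a₀ 3 * y₀ 0) * v j 1) := fun j => by
    have h := congr_fun (hv j) 2
    simp [Matrix.mulVec, dotProduct, Fin.sum_univ_four] at h
    linear_combination h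
  have r3 : ∀ j, (a₀ 1 * y₁ 2 + a₀ 2 * y₁ 1) * v j 0 + (a₀ 0 * y₁ 2 + a₀ 2 * y₁ 0) * v j 1 =
      s j * ((a₀ 1 * y₀ 2 + a₀ 2 * y₀ 1) * v j 0 + (a₀ 0 * y₀ 2 + a₀ 2 * y₀ 0) * v j 1) := fun j => by
    have h := congr_fun (hv j) 3
    simp [Matrix.mulVec, dotProduct, Fin.sum_univ_four] at h
    linear_combination h
  -- abbreviations for the `B`-blocks: `B₀₀ = [[p13, p12], [p03, p02]]`, `B₁₀ = [[q13, q12], [q03, q02]]`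
  set p13 := a₀ 1 * y₀ 3 + a₀ 3 * y₀ 1 with hp13
  set p12 := a₀ 1 * y₀ 2 + a₀ 2 * y₀ 1 with hp12
  set p03 := a₀ 0 * y₀ 3 + a₀ 3 * y₀ 0 with hp03
  set p02 := a₀ 0 * y₀ 2 + a₀ 2 * y₀ 0 with hp02
  set q13 := a₀ 1 * y₁ 3 + a₀ 3 * y₁ 1 with hq13
  set q12 := a₀ 1 * y₁ 2 + a₀ 2 * y₁ 1 with hq12
  set q03 := a₀ 0 * y₁ 3 + a₀ 3 * y₁ 0 with hq03
  set q02 := a₀ 0 * y₁ 2 + a₀ 2 * y₁ 0 with hq02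
  -- the quadratic `D(s) = det (B₁₀ - s B₀₀) = α s² + β s + γ` vanishes at every eigenvalue
  have key : ∀ j, (p13 * p02 - p03 * p12) * s j ^ 2
      - (q13 * p02 + p13 * q02 - q12 * p03 - p12 * q03) * s j + (q13 * q02 - q12 * q03) = 0 := by
    intro j
    by_cases hh : v j 0 = 0 ∧ v j 1 = 0
    · -- head zero: rows 0, 1 on the tail `g = (v j 2, v j 3) ≠ 0`
      have gne : ¬ (v j 2 = 0 ∧ v j 3 = 0) := by
        intro hg
        apply vne j
        funext k
        fin_cases k
        · exact hh.1
        · exact hh.2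
        · exact hg.1
        · exact hg.2
      have R0 : (q13 - s j * p13) * v j 2 + (q12 - s j * p12) * v j 3 = 0 := by
        linear_combination r0 j + (s j * (a₀ 2 * y₀ 3 + a₀ 3 * y₀ 2) - (a₀ 2 * y₁ 3 + a₀ 3 * y₁ 2)) * hh.2
      have R1 : (q03 - s j * p03) * v j 2 + (q02 - s j * p02) * v j 3 = 0 := by
        linear_combination r1 j + (s j * (a₀ 2 * y₀ 3 + a₀ 3 * y₀ 2) - (a₀ 2 * y₁ 3 + a₀ 3 * y₁ 2)) * hh.1
      rcases not_and_or.1 gne with g2 | g3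
      · have h : ((p13 * p02 - p03 * p12) * s j ^ 2
            - (q13 * p02 + p13 * q02 - q12 * p03 - p12 * q03) * s j + (q13 * q02 - q12 * q03))
            * v j 2 = 0 := by
          linear_combination (q02 - s j * p02) * R0 - (q12 - s j * p12) * R1
        exact (mul_eq_zero.1 h).resolve_right g2
      · have h : ((p13 * p02 - p03 * p12) * s j ^ 2
            - (q13 * p02 + p13 * q02 - q12 * p03 - p12 * q03) * s j + (q13 * q02 - q12 * q03))
            * v j 3 = 0 := by
          linear_combination (q13 - s j * p13) * R1 - (q03 - s j * p03) * R0
        exact (mul_eq_zero.1 h).resolve_right g3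
    · -- head non-zero: rows 2, 3 on the head `(v j 0, v j 1)`
      have R2 : (q13 - s j * p13) * v j 0 + (q03 - s j * p03) * v j 1 = 0 := by
        linear_combination r2 j
      have R3 : (q12 - s j * p12) * v j 0 + (q02 - s j * p02) * v j 1 = 0 := by
        linear_combination r3 j
      rcases not_and_or.1 hh with h0 | h1
      · have h : ((p13 * p02 - p03 * p12) * s j ^ 2
            - (q13 * p02 + p13 * q02 - q12 * p03 - p12 * q03) * s j + (q13 * q02 - q12 * q03))
            * v j 0 = 0 := by
          linear_combination (q02 - s j * p02) * R2 - (q03 - s j * p03) * R3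
        exact (mul_eq_zero.1 h).resolve_right h0
      · have h : ((p13 * p02 - p03 * p12) * s j ^ 2
            - (q13 * p02 + p13 * q02 - q12 * p03 - p12 * q03) * s j + (q13 * q02 - q12 * q03))
            * v j 1 = 0 := by
          linear_combination (q13 - s j * p13) * R3 - (q12 - s j * p12) * R2
        exact (mul_eq_zero.1 h).resolve_right h1
  -- three distinct roots of a non-zero quadratic: impossible
  have t01 : (p13 * p02 - p03 * p12) * (s 0 + s 1)
      - (q13 * p02 + p13 * q02 - q12 * p03 - p12 * q03) = 0 := by
    have h : (s 0 - s 1) * ((p13 * p02 - p03 * p12) * (s 0 + s 1)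
        - (q13 * p02 + p13 * q02 - q12 * p03 - p12 * q03)) = 0 := by
      linear_combination key 0 - key 1
    rcases mul_eq_zero.1 h with h | h
    · exact absurd (sub_eq_zero.1 h) (hs 0 1 (by decide))
    · exact h
  have t02 : (p13 * p02 - p03 * p12) * (s 0 + s 2)
      - (q13 * p02 + p13 * q02 - q12 * p03 - p12 * q03) = 0 := by
    have h : (s 0 - s 2) * ((p13 * p02 - p03 * p12) * (s 0 + s 2)
        - (q13 * p02 + p13 * q02 - q12 * p03 - p12 * q03)) = 0 := by
      linear_combination key 0 - key 2
    rcases mul_eq_zero.1 h with h | h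
    · exact absurd (sub_eq_zero.1 h) (hs 0 2 (by decide))
    · exact h
  have h12 : (p13 * p02 - p03 * p12) * (s 1 - s 2) = 0 := by linear_combination t01 - t02
  rcases mul_eq_zero.1 h12 with h | h
  · exact hα h
  · exact hs 1 2 (by decide) (sub_eq_zero.1 h)

/-- **`hframes` is false over every field**: the hypothesis
`∀ Ψ, ∃ a₀ a₁ y₀ y₁ P₀₀ P₁₀ P₀₁ P₁₁ W₀ v s W, …` of
`…PeeledTwoPencilReduction.false_of_peeled_of_frames` / `IR11_of_frames` /
`false_of_rank_eight_le_twentyEight_of_frames` (verbatim) is unsatisfiable — those theorems are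
vacuously hypothesised. [folklore] -/
theorem not_twoPencilFrames_forall (K : Type u) [Field K] :
    ¬ ∀ Ψ : Matrix (Fin 4) (Fin 4) K,
      ∃ (a₀ a₁ y₀ y₁ : Fin 4 → K) (P₀₀ P₁₀ P₀₁ P₁₁ W₀ : Matrix (Fin 4) (Fin 4) K)
        (v : Fin 4 → Fin 4 → K) (s : Fin 4 → K) (W : Matrix (Fin 4) (Fin 4) K),
        a₀ ⬝ᵥ Ψ *ᵥ y₀ = 0 ∧ a₀ ⬝ᵥ Ψ *ᵥ y₁ = 0 ∧ a₁ ⬝ᵥ Ψ *ᵥ y₀ = 0 ∧ a₁ ⬝ᵥ Ψ *ᵥ y₁ = 0 ∧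
        (∀ b l, P₀₀ b l = (Matrix.of ![a₀, Pi.single b 1, y₀, Pi.single l 1]).permanent) ∧
        (∀ b l, P₁₀ b l = (Matrix.of ![a₀, Pi.single b 1, y₁, Pi.single l 1]).permanent) ∧
        (∀ b l, P₀₁ b l = (Matrix.of ![a₁, Pi.single b 1, y₀, Pi.single l 1]).permanent) ∧
        (∀ b l, P₁₁ b l = (Matrix.of ![a₁, Pi.single b 1, y₁, Pi.single l 1]).permanent) ∧
        W₀ * P₀₀ = 1 ∧ (∀ j, P₁₀ *ᵥ v j = s j • P₀₀ *ᵥ v j) ∧ (∀ i j, i ≠ j → s i ≠ s j) ∧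
        W * Matrix.of v = 1 ∧ P₁₁ - P₁₀ * W₀ * P₀₁ ≠ 0 :=
  fun h => no_twoPencilFrame_swap K (h _)

end Summit.ValiantsHypothesis.ValiantsHypothesis.Theorems.SdcSuperquadratic.Negative
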